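import Mathlib
import Summits.Ventures.PercRepro.TriangleCapFourRowCap
import Summits.Ventures.PercRepro.TriangleCapSecondBestParity

/-!
# PercRepro — THE NON-`4`-BIPARTITE HALF OF THE CELL `(k, 4, 2)`: every `K₄⁻`-free graph with `4 (k − 4) − 2`
edges on `k ≥ 10` vertices is `4`-bipartite or at least `T = 2k − 18` below the closed form — the one-triangle
family against `B2 = 4 (k − 9)` (p3, gen 45; part 198b)

The degree argument at second order on the cell `(k, 4, 2)`, every vertex type, NO induction (the deletions land
on the LANDED cells `(k − 1, 4, 0)` and `(k − 1, 4, 1)` of part 196c):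
* a vertex at the cap `k − 4`: part 198a (`four_cap`, `k ≥ 11`);
* every degree in `[4, k − 5]`: the convexity `Σ (d − 4)(k − 5 − d) ≥ 0` gives `Σ d² + 4k − 30 ≤ closed`, and
  `4k − 30 ≥ 2k − 18` (`four_two_convex`) — the vertices of degree `4` need no deletion;
* a vertex `z` of degree `≤ 1`: the cross-row deletion of part 196a (`below_cross_gen`, `B2 ≥ T`);
* a vertex `z` of degree `2`: `D − z` lies on the diagonal `(k − 1, 4, 0)` (`diag_second_order_all`): it is
  `K_{4,k−5}` — the two neighbours of `z` in `A′` make `D` `4`-bipartite (`bipSub_lift`), otherwise at most one is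
  in `A′` and `T(z) = Σ_{w ∼ z} d′(w) ≤ (k − 5) + 4` closes the count EXACTLY (the family `T` itself) — or it is
  `8 (k − 10)` below, which the neighbours at `≤ k − 6` close with room `6k − 58`;
* a vertex `z` of degree `3`: `D − z` lies on the cell `(k − 1, 4, 1)` (`one_below_second_order_gen`): `4`-bipartite
  with one missing pair (`Σ′ ≤ m′(k − 1) − (k − 3)`), the neighbours all in `A′` (`4`-bipartite) or
  `T(z) ≤ 2 (k − 5) + 4`, again EXACTLY the target — or `6 (k − 10)` below with room `4k − 36`;
* `k = 10`: by parity and the equality locus (part 185: `Σd² + 2 (k − 3) = m k` forces `4`-bipartite), the gap is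
  `≥ 2 = 2k − 18`.
`sum_del_nbhd_le_of_bipSub`: for `D − z ⊆ K(A′, A′ᶜ)` with a neighbour of `z` off `A′`, `T(z) ≤ (d − 1)(k′ − a′) + a′`.
THE WITNESS: `tFamilyGen n a r = hangEdge (bipMinusStar n a r) 1 (n − 1)` — the one-triangle family `T` of the
stability table §10bt(e) on EVERY row: `K_{a,n−a}` minus an `r`-star with a vertex hung on an edge lies on the
cell `(n + 1, a, r + a − 2)` exactly `2 (n − 2a) + 2r (a − 3)` below the closed form (`tFamilyGen_value`; at
`a = 3` it is `tFamily`, at `a = 4, r = 0` the family of this cell, `2 (k − 9)` below). Hence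
`four_two_nonbip_second_best (10 ≤ k)`: THE SECOND-BEST VALUE OF `Σ_v d(v)²` OVER THE NON-`4`-BIPARTITE `K₄⁻`-FREE
GRAPHS ON THE CELL `(k, 4, 2)` IS EXACTLY `m k − 2 (k − 3) − 2 (k − 9)`. Axioms: standard.
-/

namespace PercRepro

namespace TriangleCap

namespace C047

open Finset

variable {V : Type*} [Fintype V] [DecidableEq V]

/-- The convexity on `[4, k − 5]`: `d² + 4 (k − 5) ≤ (k − 1) d`. -/
theorem convex_vertex_four_two (d k : ℕ) (h4 : 4 ≤ d) (hd : d + 5 ≤ k) : d * d + 4 * (k - 5) ≤ (k - 1) * d := by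
  obtain ⟨e, rfl⟩ : ∃ e, d = e + 4 := ⟨d - 4, by omega⟩
  obtain ⟨c, rfl⟩ : ∃ c, k = e + 4 + 5 + c := ⟨k - (e + 4 + 5), by omega⟩
  have e1 : e + 4 + 5 + c - 5 = e + 4 + c := by omega
  have e2 : e + 4 + 5 + c - 1 = e + 8 + c := by omega
  rw [e1, e2]
  nlinarith

/-- The arithmetic of the convexity case: `10 ≤ k`, `m + 2 = 4 (k − 4)`, `S + k · 4 (k − 5) ≤ (k − 1) · 2m` ⇒
`S + 2 (k − 3) + 2 (k − 9) ≤ m k`. -/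
theorem four_two_convex_arith (k m S : ℕ) (hk : 10 ≤ k) (hm : m + 2 = 4 * (k - 4))
    (hsum : S + k * (4 * (k - 5)) ≤ (k - 1) * (2 * m)) : S + 2 * (k - 3) + 2 * (k - 9) ≤ m * k := by
  obtain ⟨t, rfl⟩ : ∃ t, k = t + 10 := ⟨k - 10, by omega⟩
  have hm' : m = 4 * t + 22 := by omega
  subst hm'
  have e1 : t + 10 - 5 = t + 5 := by omega
  have e2 : t + 10 - 1 = t + 9 := by omega
  have e3 : t + 10 - 3 = t + 7 := by omega
  have e4 : t + 10 - 9 = t + 1 := by omega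
  rw [e1, e2] at hsum
  rw [e3, e4]
  nlinarith [hsum]

omit [DecidableEq V] in
/-- **EVERY DEGREE IN `[4, k − 5]` ON THE CELL `(k, 4, 2)`:** `Σ_v d(v)² + 2 (k − 3) + 2 (k − 9) ≤ m k` for `10 ≤ k`. -/
theorem four_two_convex (D : SimpleGraph V) [DecidableRel D.Adj] (hk : 10 ≤ Fintype.card V)
    (hm : D.edgeFinset.card + 2 = 4 * (Fintype.card V - 4)) (hcap : ∀ v, deg D v + 5 ≤ Fintype.card V)
    (hdeg : ∀ v, 4 ≤ deg D v) :
    ∑ v, deg D v * deg D v + 2 * (Fintype.card V - 3) + 2 * (Fintype.card V - 9) ≤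
      D.edgeFinset.card * Fintype.card V := by
  have hsum : ∑ v, (deg D v * deg D v + 4 * (Fintype.card V - 5)) ≤ ∑ v, (Fintype.card V - 1) * deg D v :=
    sum_le_sum (fun v _ => convex_vertex_four_two (deg D v) (Fintype.card V) (hdeg v) (hcap v))
  rw [sum_add_distrib, sum_const, card_univ, smul_eq_mul, ← mul_sum, sum_deg_eq] at hsum
  exact four_two_convex_arith (Fintype.card V) D.edgeFinset.card _ hk hm hsum

/-- `I c + O a ≤ (I + O − 1) c + a` for `O ≥ 1`, `a ≤ c`. -/
theorem mixed_count_arith (I O c a : ℕ) (hO : 1 ≤ O) (ha : a ≤ c) : I * c + O * a ≤ (I + O - 1) * c + a := by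
  obtain ⟨O', rfl⟩ : ∃ O', O = O' + 1 := ⟨O - 1, by omega⟩
  have e : I + (O' + 1) - 1 = I + O' := by omega
  rw [e]
  nlinarith [Nat.mul_le_mul_left O' ha]

/-- **THE NEIGHBOURS OF `z` IN A BIPARTITE `D − z`, NOT ALL ON THE SMALL SIDE:** if `D − z ⊆ K(A′, A′ᶜ)` with
`|A′| = a′`, `2a′ ≤ k′`, and some neighbour of `z` is off `A′`, then `Σ_{w ∼ z} d′(w) ≤ (d − 1)(k′ − a′) + a′`:
a neighbour in `A′` has `d′ ≤ k′ − a′`, one off `A′` has `d′ ≤ a′`, and at most `d − 1` are in `A′`. -/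
theorem sum_del_nbhd_le_of_bipSub (D : SimpleGraph V) [DecidableRel D.Adj] (z : V)
    (A' : Finset {v : V // v ≠ z}) (hsub : BipSub (del D z) A') (a' : ℕ) (hA' : A'.card = a')
    (hk' : 2 * a' ≤ Fintype.card {v : V // v ≠ z}) (w₀ : {v : V // v ≠ z}) (hw₀ : D.Adj w₀.1 z)
    (hw₀A : w₀ ∉ A') :
    ∑ w : {v : V // v ≠ z}, (if D.Adj w.1 z then deg (del D z) w else 0) ≤
      (deg D z - 1) * (Fintype.card {v : V // v ≠ z} - a') + a' := by
  obtain ⟨S, hS⟩ : ∃ S : Finset {v : V // v ≠ z}, S = univ.filter (fun w => D.Adj w.1 z) := ⟨_, rfl⟩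
  have hScard : S.card = deg D z := by rw [hS]; exact card_nbhd_del D z
  have hmemS : ∀ w, w ∈ S ↔ D.Adj w.1 z := fun w => by rw [hS, mem_filter]; simp only [mem_univ, true_and]
  rw [← sum_filter, ← hS]
  have h1 : ∑ w ∈ S, deg (del D z) w ≤
      ∑ w ∈ S, (if w ∈ A' then Fintype.card {v : V // v ≠ z} - a' else a') := by
    apply sum_le_sum
    intro w _
    by_cases hw : w ∈ A'
    · simp only [hw, if_true]
      have := deg_le_of_bipSub_mem (del D z) A' hsub w hw
      rw [hA'] at this
      exact this
    · simp only [hw, if_false]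
      have := deg_le_card_of_bipSub (del D z) A' hsub w hw
      rw [hA'] at this
      exact this
  rw [sum_ite, sum_const, sum_const, smul_eq_mul, smul_eq_mul] at h1
  have hsplit := card_filter_add_card_filter_not (s := S) (p := fun w => w ∈ A')
  have hO : 1 ≤ (S.filter (fun w => w ∉ A')).card := by
    apply card_pos.mpr
    exact ⟨w₀, mem_filter.mpr ⟨(hmemS w₀).mpr hw₀, hw₀A⟩⟩
  have hac : a' ≤ Fintype.card {v : V // v ≠ z} - a' := by omega
  have := mixed_count_arith (S.filter (fun w => w ∈ A')).card (S.filter (fun w => w ∉ A')).card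
    (Fintype.card {v : V // v ≠ z} - a') a' hO hac
  rw [hsplit, hScard] at this
  omega

/-- The arithmetic of the degree-`2` deletion onto `K_{4,k−5}`: `10 ≤ k`, `m + 2 = 4 (k − 4)`, `m′ + 2 = m`,
`S′ = m′ (k − 1)`, `T ≤ (2 − 1)(k − 1 − 4) + 4` ⇒ `S′ + 2T + 2 + 2·2 + 2 (k − 3) + 2 (k − 9) ≤ m k` (exact). -/
theorem four_two_del_two_bip_arith (k m m' S' T : ℕ) (hk : 10 ≤ k) (hm : m + 2 = 4 * (k - 4)) (hm' : m' + 2 = m)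
    (hS' : S' = m' * (k - 1)) (hT : T ≤ (2 - 1) * (k - 1 - 4) + 4) :
    S' + 2 * T + 2 + 2 * 2 + 2 * (k - 3) + 2 * (k - 9) ≤ m * k := by
  obtain ⟨t, rfl⟩ : ∃ t, k = t + 10 := ⟨k - 10, by omega⟩
  have hm1 : m = 4 * t + 22 := by omega
  have hm2 : m' = 4 * t + 20 := by omega
  subst hm1 hm2 hS'
  have e1 : t + 10 - 1 = t + 9 := by omega
  have e2 : t + 10 - 1 - 4 = t + 5 := by omega
  have e3 : t + 10 - 3 = t + 7 := by omega
  have e4 : t + 10 - 9 = t + 1 := by omega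
  rw [e1, e3, e4]
  rw [e2] at hT
  nlinarith [hT]

/-- The arithmetic of the degree-`2` deletion onto a non-`4`-bipartite `D − z`: `10 ≤ k`, `m + 2 = 4 (k − 4)`,
`m′ + 2 = m`, `S′ + 2·4 (k − 1 − 8 − 1) ≤ m′ (k − 1)`, `T ≤ 2 (k − 6)` ⇒ the target (room `6k − 58`). -/
theorem four_two_del_two_gap_arith (k m m' S' T : ℕ) (hk : 10 ≤ k) (hm : m + 2 = 4 * (k - 4)) (hm' : m' + 2 = m)
    (hS' : S' + 2 * 4 * (k - 1 - 2 * 4 - 1) ≤ m' * (k - 1)) (hT : T ≤ 2 * (k - 6)) :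
    S' + 2 * T + 2 + 2 * 2 + 2 * (k - 3) + 2 * (k - 9) ≤ m * k := by
  obtain ⟨t, rfl⟩ : ∃ t, k = t + 10 := ⟨k - 10, by omega⟩
  have hm1 : m = 4 * t + 22 := by omega
  have hm2 : m' = 4 * t + 20 := by omega
  subst hm1 hm2
  have e1 : t + 10 - 1 = t + 9 := by omega
  have e2 : t + 10 - 1 - 2 * 4 - 1 = t := by omega
  have e3 : t + 10 - 3 = t + 7 := by omega
  have e4 : t + 10 - 9 = t + 1 := by omega
  have e5 : t + 10 - 6 = t + 4 := by omega
  rw [e2, e1] at hS'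
  rw [e5] at hT
  rw [e3, e4]
  nlinarith [hS', hT]

/-- The arithmetic of the degree-`3` deletion onto a `4`-bipartite `D − z` with one missing pair: `10 ≤ k`,
`m + 2 = 4 (k − 4)`, `m′ + 3 = m`, `S′ + (k − 1 − 1 − 1) ≤ m′ (k − 1)`, `T ≤ (3 − 1)(k − 1 − 4) + 4` ⇒ the target
(exact). -/
theorem four_two_del_three_bip_arith (k m m' S' T : ℕ) (hk : 10 ≤ k) (hm : m + 2 = 4 * (k - 4))
    (hm' : m' + 3 = m) (hS' : S' + 1 * (k - 1 - 1 - 1) ≤ m' * (k - 1)) (hT : T ≤ (3 - 1) * (k - 1 - 4) + 4) :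
    S' + 2 * T + 3 + 3 * 3 + 2 * (k - 3) + 2 * (k - 9) ≤ m * k := by
  obtain ⟨t, rfl⟩ : ∃ t, k = t + 10 := ⟨k - 10, by omega⟩
  have hm1 : m = 4 * t + 22 := by omega
  have hm2 : m' = 4 * t + 19 := by omega
  subst hm1 hm2
  have e1 : t + 10 - 1 = t + 9 := by omega
  have e2 : t + 10 - 1 - 1 - 1 = t + 7 := by omega
  have e3 : t + 10 - 3 = t + 7 := by omega
  have e4 : t + 10 - 9 = t + 1 := by omega
  have e5 : t + 10 - 1 - 4 = t + 5 := by omega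
  rw [e2, e1] at hS'
  rw [e5] at hT
  rw [e3, e4]
  nlinarith [hS', hT]

/-- The arithmetic of the degree-`3` deletion onto a non-`4`-bipartite `D − z`: `10 ≤ k`, `m + 2 = 4 (k − 4)`,
`m′ + 3 = m`, `S′ + (k − 1 − 2) + 2 (k − 1 − 8 − 1) · 3 ≤ m′ (k − 1)`, `T ≤ 3 (k − 6)` ⇒ the target (room `4k − 36`). -/
theorem four_two_del_three_gap_arith (k m m' S' T : ℕ) (hk : 10 ≤ k) (hm : m + 2 = 4 * (k - 4))
    (hm' : m' + 3 = m) (hS' : S' + (k - 1 - 2) + 2 * (k - 1 - 2 * 4 - 1) * (4 - 1) ≤ m' * (k - 1))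
    (hT : T ≤ 3 * (k - 6)) :
    S' + 2 * T + 3 + 3 * 3 + 2 * (k - 3) + 2 * (k - 9) ≤ m * k := by
  obtain ⟨t, rfl⟩ : ∃ t, k = t + 10 := ⟨k - 10, by omega⟩
  have hm1 : m = 4 * t + 22 := by omega
  have hm2 : m' = 4 * t + 19 := by omega
  subst hm1 hm2
  have e1 : t + 10 - 1 = t + 9 := by omega
  have e2 : t + 10 - 1 - 2 = t + 7 := by omega
  have e3 : t + 10 - 1 - 2 * 4 - 1 = t := by omega
  have e4 : t + 10 - 3 = t + 7 := by omega
  have e5 : t + 10 - 9 = t + 1 := by omega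
  have e6 : t + 10 - 6 = t + 4 := by omega
  rw [e3, e2, e1] at hS'
  rw [e6] at hT
  rw [e4, e5]
  nlinarith [hS', hT]

/-- **A VERTEX OF DEGREE `2` ON THE CELL `(k, 4, 2)`, `10 ≤ k`:** `D − z` lies on the diagonal `(k − 1, 4, 0)`;
`D` is `4`-bipartite or `Σ_v d(v)² + 2 (k − 3) + 2 (k − 9) ≤ m k`. -/
theorem four_two_del_two (D : SimpleGraph V) [DecidableRel D.Adj] (hK : K4mFree D) (hk : 10 ≤ Fintype.card V)
    (hm : D.edgeFinset.card + 2 = 4 * (Fintype.card V - 4)) (hcap : ∀ v, deg D v + 5 ≤ Fintype.card V) (z : V)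
    (hz : deg D z = 2) :
    (∃ A : Finset V, A.card = 4 ∧ BipSub D A) ∨
      ∑ v, deg D v * deg D v + 2 * (Fintype.card V - 3) + 2 * (Fintype.card V - 9) ≤
        D.edgeFinset.card * Fintype.card V := by
  have hK' := k4mFree_del D hK z
  have hcard' := card_del z
  have hedges' := card_edges_del D z
  have hsq := sum_deg_sq_del D z
  rw [hz] at hedges' hsq
  obtain ⟨k, hk'⟩ : ∃ k, Fintype.card V = k := ⟨_, rfl⟩
  have hcardW' : Fintype.card {v : V // v ≠ z} = k - 1 := by omega
  obtain ⟨m, hmdef⟩ : ∃ m, D.edgeFinset.card = m := ⟨_, rfl⟩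
  obtain ⟨m', hm'def⟩ : ∃ m', (del D z).edgeFinset.card = m' := ⟨_, rfl⟩
  rw [hmdef] at hedges' hm
  rw [hm'def] at hedges'
  rw [hk'] at hm hk hcap
  have hm' : (del D z).edgeFinset.card = 4 * (Fintype.card {v : V // v ≠ z} - 4) := by
    rw [hm'def, hcardW']
    have e : 4 * (k - 4) = 4 * (k - 1 - 4) + 4 := by omega
    omega
  obtain ⟨T, hTdef⟩ : ∃ T, ∑ w : {v : V // v ≠ z}, (if D.Adj w.1 z then deg (del D z) w else 0) = T := ⟨_, rfl⟩
  obtain ⟨S', hS'def⟩ : ∃ S', ∑ w : {v : V // v ≠ z}, deg (del D z) w * deg (del D z) w = S' := ⟨_, rfl⟩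
  rw [hTdef, hS'def] at hsq
  rcases diag_second_order_all (del D z) hK' 4 (by norm_num) (by omega) hm' with ⟨A', hA'card, hA'⟩ | hgap
  · -- `D − z = K_{4,k−5}`
    by_cases hin : ∀ w : {v : V // v ≠ z}, D.Adj w.1 z → w ∈ A'
    · obtain ⟨B, hBcard, hB⟩ := bipSub_lift D z A' hA' hin
      exact Or.inl ⟨B, by rw [hBcard, hA'card], hB⟩
    · right
      push Not at hin
      obtain ⟨w₀, hw₀, hw₀A⟩ := hin
      have hT := sum_del_nbhd_le_of_bipSub D z A' hA' 4 hA'card (by omega) w₀ hw₀ hw₀A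
      rw [hTdef, hz, hcardW'] at hT
      haveI : Nonempty {v : V // v ≠ z} := Fintype.card_pos_iff.mp (by omega)
      have hS' := sum_deg_sq_eq_of_bipSub_full (del D z) A' 4 hA'card hA' hm' inferInstance
      rw [hS'def, hm'def, hcardW'] at hS'
      rw [hsq, hmdef, hk']
      exact four_two_del_two_bip_arith k m m' S' T hk hm hedges' hS' hT
  · right
    have hT := sum_del_nbhd_le D z (k - 6) (fun v => by have := hcap v; omega)
    rw [hTdef, hz] at hT
    rw [hS'def, hm'def, hcardW'] at hgap
    rw [hsq, hmdef, hk']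
    exact four_two_del_two_gap_arith k m m' S' T hk hm hedges' hgap hT

/-- **A VERTEX OF DEGREE `3` ON THE CELL `(k, 4, 2)`, `10 ≤ k`:** `D − z` lies on the cell `(k − 1, 4, 1)`;
`D` is `4`-bipartite or `Σ_v d(v)² + 2 (k − 3) + 2 (k − 9) ≤ m k`. -/
theorem four_two_del_three (D : SimpleGraph V) [DecidableRel D.Adj] (hK : K4mFree D) (hk : 10 ≤ Fintype.card V)
    (hm : D.edgeFinset.card + 2 = 4 * (Fintype.card V - 4)) (hcap : ∀ v, deg D v + 5 ≤ Fintype.card V) (z : V)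
    (hz : deg D z = 3) :
    (∃ A : Finset V, A.card = 4 ∧ BipSub D A) ∨
      ∑ v, deg D v * deg D v + 2 * (Fintype.card V - 3) + 2 * (Fintype.card V - 9) ≤
        D.edgeFinset.card * Fintype.card V := by
  have hK' := k4mFree_del D hK z
  have hcard' := card_del z
  have hedges' := card_edges_del D z
  have hsq := sum_deg_sq_del D z
  rw [hz] at hedges' hsq
  obtain ⟨k, hk'⟩ : ∃ k, Fintype.card V = k := ⟨_, rfl⟩
  have hcardW' : Fintype.card {v : V // v ≠ z} = k - 1 := by omega
  obtain ⟨m, hmdef⟩ : ∃ m, D.edgeFinset.card = m := ⟨_, rfl⟩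
  obtain ⟨m', hm'def⟩ : ∃ m', (del D z).edgeFinset.card = m' := ⟨_, rfl⟩
  rw [hmdef] at hedges' hm
  rw [hm'def] at hedges'
  rw [hk'] at hm hk hcap
  have hm' : (del D z).edgeFinset.card + 1 = 4 * (Fintype.card {v : V // v ≠ z} - 4) := by
    rw [hm'def, hcardW']
    have e : 4 * (k - 4) = 4 * (k - 1 - 4) + 4 := by omega
    omega
  obtain ⟨T, hTdef⟩ : ∃ T, ∑ w : {v : V // v ≠ z}, (if D.Adj w.1 z then deg (del D z) w else 0) = T := ⟨_, rfl⟩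
  obtain ⟨S', hS'def⟩ : ∃ S', ∑ w : {v : V // v ≠ z}, deg (del D z) w * deg (del D z) w = S' := ⟨_, rfl⟩
  rw [hTdef, hS'def] at hsq
  rcases one_below_second_order_gen (del D z) hK' 4 (le_refl 4) (by omega) hm' with ⟨A', hA'card, hA'⟩ | hgap
  · -- `D − z ⊆ K_{4,k−5}` with one missing pair
    by_cases hin : ∀ w : {v : V // v ≠ z}, D.Adj w.1 z → w ∈ A'
    · obtain ⟨B, hBcard, hB⟩ := bipSub_lift D z A' hA' hin
      exact Or.inl ⟨B, by rw [hBcard, hA'card], hB⟩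
    · right
      push Not at hin
      obtain ⟨w₀, hw₀, hw₀A⟩ := hin
      have hT := sum_del_nbhd_le_of_bipSub D z A' hA' 4 hA'card (by omega) w₀ hw₀ hw₀A
      rw [hTdef, hz, hcardW'] at hT
      have hS' := sum_deg_sq_le_of_bipSub (del D z) A' hA' 4 1 hA'card hm' (by omega)
      rw [hS'def, hm'def, hcardW'] at hS'
      rw [hsq, hmdef, hk']
      exact four_two_del_three_bip_arith k m m' S' T hk hm hedges' hS' hT
  · right
    have hT := sum_del_nbhd_le D z (k - 6) (fun v => by have := hcap v; omega)
    rw [hTdef, hz] at hT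
    rw [hS'def, hm'def, hcardW'] at hgap
    rw [hsq, hmdef, hk']
    exact four_two_del_three_gap_arith k m m' S' T hk hm hedges' hgap hT

/-- **THE CELL `(k, 4, 2)` AT `k = 10` BY PARITY:** a non-`4`-bipartite graph is not extremal (part 185), and
`Σ_v d(v)²` and the closed form are even. -/
theorem four_two_ten (D : SimpleGraph V) [DecidableRel D.Adj] (hK : K4mFree D) (hk : Fintype.card V = 10)
    (hm : D.edgeFinset.card + 2 = 4 * (Fintype.card V - 4)) :
    (∃ A : Finset V, A.card = 4 ∧ BipSub D A) ∨
      ∑ v, deg D v * deg D v + 2 * (Fintype.card V - 3) + 2 * (Fintype.card V - 9) ≤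
        D.edgeFinset.card * Fintype.card V := by
  by_cases heq : ∑ v, deg D v * deg D v + 2 * (Fintype.card V - 1 - 2) = D.edgeFinset.card * Fintype.card V
  · exact Or.inl (bipSub_of_closed_form_eq D hK 4 2 (by norm_num) (by omega) (by omega) (by omega) heq)
  · right
    have hle := closed_form_stability D hK 4 2 (by norm_num) (by omega) (by omega)
    obtain ⟨p, hp⟩ := even_sum_deg_sq D
    obtain ⟨q, hq⟩ : Even (D.edgeFinset.card * Fintype.card V) := by
      have h1 := even_mul_sub_mul 4 (Fintype.card V) (by omega)
      have h2 : D.edgeFinset.card * Fintype.card V + 2 * Fintype.card V = 4 * (Fintype.card V - 4) * Fintype.card V := by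
        rw [← add_mul, hm]
      have h3 : Even (D.edgeFinset.card * Fintype.card V + 2 * Fintype.card V) := by rw [h2]; exact h1
      exact (Nat.even_add.mp h3).mpr (even_two_mul _)
    rw [hk] at hle heq hq ⊢
    omega

/-- **THE NON-`4`-BIPARTITE HALF OF THE CELL `(k, 4, 2)`, EVERY VERTEX TYPE:** `K₄⁻`-free, `10 ≤ k`,
`m + 2 = 4 (k − 4)` ⇒ `D` is a spanning subgraph of some `K(A, Aᶜ)` with `|A| = 4`, or
`Σ_v d(v)² + 2 (k − 3) + 2 (k − 9) ≤ m k` — the one-triangle family `T = 2k − 18` of the stability table §10bt(e),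
sharp (`tFamilyGen_value`). -/
theorem four_two_second_order (D : SimpleGraph V) [DecidableRel D.Adj] (hK : K4mFree D)
    (hk : 10 ≤ Fintype.card V) (hm : D.edgeFinset.card + 2 = 4 * (Fintype.card V - 4)) :
    (∃ A : Finset V, A.card = 4 ∧ BipSub D A) ∨
      ∑ v, deg D v * deg D v + 2 * (Fintype.card V - 3) + 2 * (Fintype.card V - 9) ≤
        D.edgeFinset.card * Fintype.card V := by
  rcases Nat.lt_or_ge (Fintype.card V) 11 with hk10 | hk11
  · exact four_two_ten D hK (by omega) hm
  -- (A) a vertex at the cap `k − 4`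
  by_cases hx : ∃ x, deg D x + 4 = Fintype.card V
  · obtain ⟨x, hx⟩ := hx
    exact four_cap D hK hk11 hm x hx
  push Not at hx
  have hcap : ∀ v, deg D v + 4 ≤ Fintype.card V := fun v =>
    deg_add_le_card_of_dense D hK 4 (by omega) (by omega)
      (cap_arith 4 (Fintype.card V) D.edgeFinset.card 2 (by omega) (by omega)
        (below_cap_arith 4 (Fintype.card V) D.edgeFinset.card 2 (by omega) hm)) v
  have hcap' : ∀ v, deg D v + 5 ≤ Fintype.card V := fun v => by
    have h1 := hcap v
    have h2 := hx v
    omega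
  -- (B) every degree `≥ 4`: the convexity on `[4, k − 5]`
  by_cases hdeg : ∀ v, 4 ≤ deg D v
  · exact Or.inr (four_two_convex D hk hm hcap' hdeg)
  push Not at hdeg
  obtain ⟨z, hz⟩ := hdeg
  -- (C) a vertex of degree `≤ 1`: the cross-row deletion
  rcases Nat.lt_or_ge (deg D z) 2 with hz1 | hz2
  · right
    have h := below_cross_gen D hK 4 2 (by norm_num) (by omega) hm hcap' z (by omega)
    have e1 : Fintype.card V - 1 - 2 = Fintype.card V - 3 := by omega
    have e2 : Fintype.card V - 2 * 4 - 1 = Fintype.card V - 9 := by omega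
    rw [e1, e2] at h
    omega
  -- (D) a vertex of degree `2` or `3`
  rcases Nat.lt_or_ge (deg D z) 3 with hz2' | hz3
  · exact four_two_del_two D hK hk hm hcap' z (by omega)
  · exact four_two_del_three D hK hk hm hcap' z (by omega)

end C047

end TriangleCap

end PercRepro
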